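import Summits.ResolutionOfSingularities.ResolutionOfSingularities.Theorems.FrobeniusClosingPatchingRelPerfectDepthPhaseCReachableFamilies
import HarnessLib

/-!
# Crux `PatchingRelPerfect` (stmt-ResolutionOfSingularities-16161), chain W5.2 — F7(β) (β-AX) PHASE C,
# REACHABLE FAMILIES (iv): the `(α_m)` run for EVERY `m` — head and the two-exponent descent of branch B

[OURS · L1 W5.2 · F7(β) (β-AX) Phase C · res-L1-w52-plan-1 ANSWER 2026-08-27T16:09:56Z «RUNS» («the uniform-in-`m`
induction ONLY if it closes in ≤ 150 l. — it is LT-2's instance»); companion of `…DepthPhaseCReachableFamilies` (`(α₂)`),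
`…Alpha3` (`(α₃)`), `…Pocket`] res-L1-w52-stub-2 g5.  Replaces the role of NO printed item; NOT a statement of the manuscript
under review (AI-written, weaker than expert review).  Reachability is asserted (tri-2 v11.3 N3) for `m = 2` only.

THE UNIFORM SHAPE OF BRANCH B.  For `(α_{m+2})`: `K = (x) + (x + y^{m+2}) + (z t²)`, the first two S1♯ moves are uniform in
`m` — move 1 `W₁ = V(x, y, t)` (TB2), `t`-chart `K ↦ g · B₁`, `B₁ = (x) + (x + t^{m+1} y^{m+2}) + (z t)` (`alphaT_gen`; `x`-chart
`(g)`: `alphaX_gen`); move 2 `W₂ = H₁′ ∩ F₁ = V(x, t)` (the surface), `t`-chart `B₁ ↦ h · D(m, m+2)` (`B1_gen_T`; `x`-chart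
`(h)`: `B1_gen_X`) — and land in the TWO-EXPONENT family

  `D(a, b) = (x) + (x + t^a y^b) + (z)`,  members `t, y, z` (both `t` and `y` are exceptional letters from here on),

whose S1♯ moves are the blowing ups of the two cosupport lines `V(x, y, z)` (TM-preferred when `b ≥ a`: host contact `b`)
and `V(x, t, z)` (when `a ≥ b`), each LOWERING `a + b` BY ONE and ending on the other charts:
* `descentY`: `V(x, y, z)`, `y`-chart: `D(a, b+1) ↦ k · D(a, b)`; `descentX`, `descentZ`: the `x`- and `z`-charts are `(k)`;
* `descentT`: `V(x, t, z)`, `t`-chart: `D(a+1, b) ↦ h · D(a, b)`; `descentXt`, `descentZt`: the other two charts are `(h)`;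
* `descent_le_Y`, `descent_le_T`: both moves are legal (`ν = 1`, both hosts contain the centre);
* `descent_end`: `D(0, 0) = (x) + (x + 1) + (z) = (1)` — EMPTY cosupport.
Hence the worst branch of the S1♯ run of `(α_{m+2})` has exactly `2 + (m + (m + 2)) = 2(m + 2)` moves — tri-2's TMN value
`2m` for `(α_m)` (kit j283236, `m ≤ 6`) for every `m`, in the STRONG currency trivially (empty cosupport).  Measure read
off for X3: `Φ_B = a + b` (sum of the exponents of the two exceptional letters in the tangent host) drops by one per move;
`(dim W, contact, ord N) = (1, max(a,b), 1)` does NOT drop at the tie steps `a = b` — the sum does.  BRANCH A is SELF-SIMILAR: move 1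
`y`-chart `K ↦ g · A₁(m)`, `A₁(m) = (x) + (x + y^{m+1}) + (z y t²)` (`alphaY_gen`), move 2 `W₂ = H₁′ ∩ F₁ = V(x, y)`,
`y`-chart `A₁(m) ↦ h · (α_m)(x′, h, z, t)` (`A1_gen_Y`; `x`-chart `(h)`, `A1_gen_X`) — the `(α_m)` germ two orders lower with
the exceptional `h` in the slot of `y` (the chart identities do not see member-ship, so the same lemmas run it); bases
`(α₀) = (1)` (`alpha_zero_top`) and `(α₁) = A₂` of `…Alpha3` (3 moves).  So for every `m` the S1♯ run of `(α_m)` ENDS with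
empty cosupport, worst length `L(m) = 2m` (`L(m+2) = max(2 + L(m), 2 + 2m + 2)`).

Fact-free; design / termination evidence for X3 (idea-1 LT-2); no E-side content; substitution identities only.

## References
* The Stacks Project, Tags 0804, 0BIQ (affine blow-up algebras and their charts). [StacksProject]
* J. Kollár, *Lectures on Resolution of Singularities* (2007), (3.111) Step 3 (monomial bookkeeping). [Kollar2007]
-/

-- `Summit.<Summit>.<Sub>.Theorems` with `Sub = Summit` (single-conjunct summit, D-0017)
set_option linter.dupNamespace false

noncomputable section

open IsLocalRing Literature.AlgebraicGeometry.Resolution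

namespace Summit.ResolutionOfSingularities.ResolutionOfSingularities.Theorems

universe u

namespace DepthPhaseCRuns

open DepthPhaseC CuspMember

/-- `(α_m)`: `K = (x) + (x + y^m) + (z t²)`. -/
local notation3 "Kα[" x "," y "," z "," t "," m "]" =>
  (Ideal.span {x} ⊔ Ideal.span {x + y ^ m} ⊔ Ideal.span {z * t ^ 2})
/-- Branch B after move 1, general `m`: `B₁ = (x) + (x + t^{m+1} y^{m+2}) + (z t)`. -/
local notation3 "B1g[" x "," y "," z "," t "," m "]" =>
  (Ideal.span {x} ⊔ Ideal.span {x + t ^ (m + 1) * y ^ (m + 2)} ⊔ Ideal.span {z * t})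
/-- Branch A after move 1, general `m`: `A₁ = (x) + (x + y^{m+1}) + (z y t²)`. -/
local notation3 "A1g[" x "," y "," z "," t "," m "]" =>
  (Ideal.span {x} ⊔ Ideal.span {x + y ^ (m + 1)} ⊔ Ideal.span {z * y * t ^ 2})
/-- The two-exponent family `D(a, b) = (x) + (x + t^a y^b) + (z)`. -/
local notation3 "D[" x "," y "," z "," t "," a "," b "]" =>
  (Ideal.span {x} ⊔ Ideal.span {x + t ^ a * y ^ b} ⊔ Ideal.span {z})

variable {A : Type u} [CommRing A]

/-! ## §1 The head of the run, general `m` -/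

/-- **Move 1 is legal** for every `m`: `K ≤ (x, y, t)`. [folklore] -/
theorem alpha_gen_le (x y z t : A) (m : ℕ) : Kα[x, y, z, t, m + 2] ≤ Ideal.span (Set.range ![x, y, t]) := by
  rw [span_range_vec3]
  refine sup_le (sup_le (le_sup_of_le_left le_sup_left) ?_) ?_
  · rw [Ideal.span_singleton_le_iff_mem]
    exact Ideal.add_mem _ (Ideal.mem_sup_left (Ideal.mem_sup_left (Ideal.mem_span_singleton_self x)))
      (Ideal.mem_sup_left (Ideal.mem_sup_right (Ideal.mem_span_singleton.mpr ⟨y ^ (m + 1), by ring⟩)))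
  · rw [Ideal.span_singleton_le_iff_mem]
    exact Ideal.mem_sup_right (Ideal.mem_span_singleton.mpr ⟨z * t, by ring⟩)

/-- **Move 1, `x`-chart**, general `m`: `(g)`. [folklore] -/
theorem alphaX_gen (y' z t' g : A) (m : ℕ) : Kα[g, g * y', z, g * t', m + 2] = Ideal.span {g} :=
  span_sup_sup_eq ⟨1 + g ^ (m + 1) * y' ^ (m + 2), by ring⟩ ⟨z * g * t' ^ 2, by ring⟩

/-- **Move 1, `t`-chart**, general `m`: `K ↦ g · B₁(m)`. [folklore] -/
theorem alphaT_gen (x' y' z g : A) (m : ℕ) :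
    Kα[g * x', g * y', z, g, m + 2] = Ideal.span {g} * B1g[x', y', z, g, m] := by
  have e1 : g * x' + (g * y') ^ (m + 2) = g * (x' + g ^ (m + 1) * y' ^ (m + 2)) := by ring
  have e2 : z * g ^ 2 = g * (z * g) := by ring
  rw [e1, e2]
  exact (span_singleton_mul_sup₃ _ _ _ _).symm

/-- **Move 2 (B) is legal**, general `m`: `B₁ ≤ (x, t)`. [folklore] -/
theorem B1_gen_le (x y z t : A) (m : ℕ) : B1g[x, y, z, t, m] ≤ Ideal.span (Set.range ![x, t]) := by
  rw [span_range_vec2]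
  refine sup_le (sup_le le_sup_left ?_) ?_
  · rw [Ideal.span_singleton_le_iff_mem]
    exact Ideal.add_mem _ (Ideal.mem_sup_left (Ideal.mem_span_singleton_self x))
      (Ideal.mem_sup_right (Ideal.mem_span_singleton.mpr ⟨t ^ m * y ^ (m + 2), by ring⟩))
  · rw [Ideal.span_singleton_le_iff_mem]
    exact Ideal.mem_sup_right (Ideal.mem_span_singleton.mpr ⟨z, by ring⟩)

/-- **Move 2 (B), `x`-chart**, general `m`: `(h)`. [folklore] -/
theorem B1_gen_X (y z t' h : A) (m : ℕ) : B1g[h, y, z, h * t', m] = Ideal.span {h} :=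
  span_sup_sup_eq ⟨1 + h ^ m * t' ^ (m + 1) * y ^ (m + 2), by ring⟩ ⟨z * t', by ring⟩

/-- **Move 2 (B), `t`-chart**, general `m`: `B₁ ↦ h · D(m, m + 2)` — the run enters the two-exponent family.
[folklore] -/
theorem B1_gen_T (x' y z h : A) (m : ℕ) :
    B1g[h * x', y, z, h, m] = Ideal.span {h} * D[x', y, z, h, m, m + 2] := by
  have e1 : h * x' + h ^ (m + 1) * y ^ (m + 2) = h * (x' + h ^ m * y ^ (m + 2)) := by ring
  have e2 : z * h = h * z := by ring
  rw [e1, e2]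
  exact (span_singleton_mul_sup₃ _ _ _ _).symm

/-- **Move 1, `y`-chart**, general `m`: `K ↦ g · A₁(m)`. [folklore] -/
theorem alphaY_gen (x' z t' g : A) (m : ℕ) :
    Kα[g * x', g, z, g * t', m + 2] = Ideal.span {g} * A1g[x', g, z, t', m] := by
  have e1 : g * x' + g ^ (m + 2) = g * (x' + g ^ (m + 1)) := by ring
  have e2 : z * (g * t') ^ 2 = g * (z * g * t' ^ 2) := by ring
  rw [e1, e2]
  exact (span_singleton_mul_sup₃ _ _ _ _).symm

/-- **Move 2 (A) is legal**, general `m`: `A₁ ≤ (x, y)` (the surface `H₁′ ∩ F₁`). [folklore] -/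
theorem A1_gen_le (x y z t : A) (m : ℕ) : A1g[x, y, z, t, m] ≤ Ideal.span (Set.range ![x, y]) := by
  rw [span_range_vec2]
  refine sup_le (sup_le le_sup_left ?_) ?_
  · rw [Ideal.span_singleton_le_iff_mem]
    exact Ideal.add_mem _ (Ideal.mem_sup_left (Ideal.mem_span_singleton_self x))
      (Ideal.mem_sup_right (Ideal.mem_span_singleton.mpr ⟨y ^ m, by ring⟩))
  · rw [Ideal.span_singleton_le_iff_mem]
    exact Ideal.mem_sup_right (Ideal.mem_span_singleton.mpr ⟨z * t ^ 2, by ring⟩)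

/-- **Move 2 (A), `x`-chart**, general `m`: `(h)`. [folklore] -/
theorem A1_gen_X (y' z t h : A) (m : ℕ) : A1g[h, h * y', z, t, m] = Ideal.span {h} :=
  span_sup_sup_eq ⟨1 + h ^ m * y' ^ (m + 1), by ring⟩ ⟨z * y' * t ^ 2, by ring⟩

/-- **Move 2 (A), `y`-chart**, general `m`: `A₁(m) ↦ h · (α_m)(x′, h, z, t)` — after TWO moves branch A is the
`(α_m)` germ again, two contact orders lower, with the exceptional `h` in the slot of `y` (SELF-SIMILARITY of the run:
worst length `L(m+2) = max (2 + L(m), 2 + (m + (m+2))) = 2(m+2)`). [folklore] -/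
theorem A1_gen_Y (x' z t h : A) (m : ℕ) : A1g[h * x', h, z, t, m] = Ideal.span {h} * Kα[x', h, z, t, m] := by
  have e1 : h * x' + h ^ (m + 1) = h * (x' + h ^ m) := by ring
  have e2 : z * h * t ^ 2 = h * (z * t ^ 2) := by ring
  rw [e1, e2]
  exact (span_singleton_mul_sup₃ _ _ _ _).symm

/-- **Base of the self-similarity**: `(α₀) = (x) + (x + 1) + (z t²) = (1)`; `(α₁) = (x) + (x + y) + (z t²)` is the state
`A₂` of `…Alpha3` (three more moves there). [folklore] -/
theorem alpha_zero_top (x y z t : A) : Kα[x, y, z, t, 0] = ⊤ := by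
  rw [pow_zero]
  exact sup₃_eq_top_of_unit_step x (z * t ^ 2)

/-! ## §2 The two-exponent descent `D(a, b) = (x) + (x + t^a y^b) + (z)` -/

/-- **The `y`-move is legal**: `D(a, b) ≤ (x, y, z)` as soon as `b ≥ 1`. [folklore] -/
theorem descent_le_Y (x y z t : A) (a b : ℕ) : D[x, y, z, t, a, b + 1] ≤ Ideal.span (Set.range ![x, y, z]) := by
  rw [span_range_vec3]
  refine sup_le (sup_le (le_sup_of_le_left le_sup_left) ?_) le_sup_right
  rw [Ideal.span_singleton_le_iff_mem]
  exact Ideal.add_mem _ (Ideal.mem_sup_left (Ideal.mem_sup_left (Ideal.mem_span_singleton_self x)))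
    (Ideal.mem_sup_left (Ideal.mem_sup_right (Ideal.mem_span_singleton.mpr ⟨t ^ a * y ^ b, by ring⟩)))

/-- **The `t`-move is legal**: `D(a, b) ≤ (x, t, z)` as soon as `a ≥ 1`. [folklore] -/
theorem descent_le_T (x y z t : A) (a b : ℕ) : D[x, y, z, t, a + 1, b] ≤ Ideal.span (Set.range ![x, t, z]) := by
  rw [span_range_vec3]
  refine sup_le (sup_le (le_sup_of_le_left le_sup_left) ?_) le_sup_right
  rw [Ideal.span_singleton_le_iff_mem]
  exact Ideal.add_mem _ (Ideal.mem_sup_left (Ideal.mem_sup_left (Ideal.mem_span_singleton_self x)))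
    (Ideal.mem_sup_left (Ideal.mem_sup_right (Ideal.mem_span_singleton.mpr ⟨t ^ a * y ^ b, by ring⟩)))

/-- **`y`-move, `y`-chart** (`y = k`, `x = k x′`, `z = k z′`): `D(a, b+1) ↦ k · D(a, b)`. [folklore] -/
theorem descentY (x' z' t k : A) (a b : ℕ) :
    D[k * x', k, k * z', t, a, b + 1] = Ideal.span {k} * D[x', k, z', t, a, b] := by
  have e1 : k * x' + t ^ a * k ^ (b + 1) = k * (x' + t ^ a * k ^ b) := by ring
  rw [e1]
  exact (span_singleton_mul_sup₃ _ _ _ _).symm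

/-- **`y`-move, `x`-chart**: `(k)`. [folklore] -/
theorem descentX (y' z' t k : A) (a b : ℕ) : D[k, k * y', k * z', t, a, b + 1] = Ideal.span {k} :=
  span_sup_sup_eq ⟨1 + t ^ a * k ^ b * y' ^ (b + 1), by ring⟩ ⟨z', by ring⟩

/-- **`y`-move, `z`-chart**: `(k)`. [folklore] -/
theorem descentZ (x' y' t k : A) (a b : ℕ) : D[k * x', k * y', k, t, a, b + 1] = Ideal.span {k} :=
  sup_sup_span_eq ⟨x', by ring⟩ ⟨x' + t ^ a * k ^ b * y' ^ (b + 1), by ring⟩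

/-- **`t`-move, `t`-chart** (`t = h`, `x = h x′`, `z = h z′`): `D(a+1, b) ↦ h · D(a, b)`. [folklore] -/
theorem descentT (x' y z' h : A) (a b : ℕ) :
    D[h * x', y, h * z', h, a + 1, b] = Ideal.span {h} * D[x', y, z', h, a, b] := by
  have e1 : h * x' + h ^ (a + 1) * y ^ b = h * (x' + h ^ a * y ^ b) := by ring
  rw [e1]
  exact (span_singleton_mul_sup₃ _ _ _ _).symm

/-- **`t`-move, `x`-chart** (`x = h`, `t = h t′`, `z = h z′`): `(h)`. [folklore] -/
theorem descentXt (y z' t' h : A) (a b : ℕ) : D[h, y, h * z', h * t', a + 1, b] = Ideal.span {h} :=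
  span_sup_sup_eq ⟨1 + h ^ a * t' ^ (a + 1) * y ^ b, by ring⟩ ⟨z', by ring⟩

/-- **`t`-move, `z`-chart** (`z = h`, `x = h x′`, `t = h t′`): `(h)`. [folklore] -/
theorem descentZt (x' y t' h : A) (a b : ℕ) : D[h * x', y, h, h * t', a + 1, b] = Ideal.span {h} :=
  sup_sup_span_eq ⟨x', by ring⟩ ⟨x' + h ^ a * t' ^ (a + 1) * y ^ b, by ring⟩

/-- **END of the descent**: `D(0, 0) = (x) + (x + 1) + (z) = (1)` — empty cosupport, END in every currency. [folklore] -/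
theorem descent_end (x y z t : A) : D[x, y, z, t, 0, 0] = ⊤ := by
  rw [pow_zero, pow_zero, mul_one]
  exact sup₃_eq_top_of_unit_step x z

/-- **The `(α₂)` and `(α₃)` branch-B states are descent states**: `B₂ = D(0, 2)` for `(α₂)`, `B₂ = D(1, 3)`, `B₃ = D(1, 2)`,
`B₄ = D(1, 1)`, `C = D(1, 0)` for `(α₃)` (up to `t^1 = t`, `t^0 = 1`), e.g.: [folklore] -/
theorem descent_one_zero (x y z t : A) : D[x, y, z, t, 1, 0] = Ideal.span {x} ⊔ Ideal.span {x + t} ⊔ Ideal.span {z} := by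
  rw [pow_one, pow_zero, mul_one]

end DepthPhaseCRuns

end Summit.ResolutionOfSingularities.ResolutionOfSingularities.Theorems

end
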